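import Summits.BirchSwinnertonDyer.BirchSwinnertonDyer.Theorems.KatoDescentPotSupersingularFineSelmerControlRankOne
import Summits.BirchSwinnertonDyer.BirchSwinnertonDyer.Theorems.KatoDescentTamePotSupersingularTameFineSelmerFineUnitAnchor
import Summits.BirchSwinnertonDyer.BirchSwinnertonDyer.Theorems.KatoDescentPotSupersingularWildFineSelmerSmallConductorAnchor
import HarnessLib

/-!
# The RANK-ONE fine anchor road (K9 `WildFineSelmerCoatesSujatha` 19386 and KT `TameFineSelmerCoatesSujatha` 19413)

A `--supports … --as helper` file (seat `bsd-potss-conjA-anchor` g3): the congruence-anchor roads of k9-c4 g6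
(`…WildFineSelmerFineUnitAnchor`, `…TameFineSelmerFineUnitAnchor`) with the anchor's global datum
`rank W′(ℚ) = 0 ∧ #Ш(W′)[p^∞] = 1` REPLACED by RANK-ONE data:

* `#Ш(W′/ℚ)[p^∞] = 1`;
* `W′(ℚ) = ℤ·P ⊕ T` with `m · T = 0`, `p ∤ m` (a Mordell–Weil basis of record);
* `P` has no `D_p`-fixed `p`-th root in `W′(ℚ̄)` (`P ∉ p · W′(ℚ_p)`, an exact finite `p`-adic computation);
* the torsion sockets `W′[p^∞]^{D_v} = 0` on `S = {p} ∪ bad(W′)` (as in g6's road).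

Then `Sel₀(W′/ℚ_∞) = 0` (`FineSelmerControl.fineSelmerInfty_eq_bot_of_rankOne`: the fine control theorem in
its (FMW) form — a Selmer class over `ℚ` that is LOCALLY TRIVIAL at `p` is zero, by the Kummer sequence with
`Ш[p^∞] = 0` and the local indivisibility of `P`), hence (A) at `(W′, p)`, hence (A) at `(W, p)` for the
congruent row curve `W` (Lim–Sujatha), hence `MissingUpperBoundAt W p` (Kato's fine reading), exactly as in
g6's roads. The small-conductor variants discharge `#Ш(W′)[p^∞] = 1` by bsd.S31 (`N_{W′} < 5000`, rank `≤ 1`: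
`#Ш(W′) = Ш_an(W′)`, Creutz–Miller) from `p ∤ Ш_an(W′)`.

Census (seat folder `census/RANK1-ANCHORS-conjA-anchor-g3.tsv`): 75 rows of 19386/19413 without a rank-0
kernel road (61 ♯) have such a rank-one partner with `N′ < 5000` or CM, `p ∤ Ш_an`, sockets exact, and the
generator certified `p`-indivisible in `W′(ℚ_p)` (127 of 139 candidate pairs), e.g. 6912h1 ↔ 256b1
(`P = (2,2)`), 19494q1/x1 ↔ 361a1, 21600bc1/bd1 ↔ 800a1.

All hypotheses about the explicit curves stay DISPLAYED (`ModPCongruent`, the Mordell–Weil structure, the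
local indivisibility in Galois form, the sockets); nothing is decided by the kernel here. The group law on
`W′(ℚ)` in `hgen` is Mathlib's, for the classical `DecidableEq ℚ` instance (the one the tree's Kummer theory
`SelmerCorankProofs` is built on).

## References
* [GreenbergLNM1716] R. Greenberg, *Iwasawa theory for elliptic curves*, LNM 1716 (1999), §2 and Prop. 3.8.
* [LimSujatha2018] M. F. Lim, R. Sujatha, *Doc. Math.* 23 (2018), §3 Prop. 3.2.
* [Kato2004Asterisque] K. Kato, *Astérisque* 295 (2004), Thm. 14.5 (3), Prop. 14.16 (2).
* [CreutzMiller2012] B. Creutz, R. L. Miller, *Second isogeny descents and the Birch and Swinnerton-Dyer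
  conjectural formula*, J. Algebra 372 (2012), Thm. 1.1 (BSD for `N < 5000`, rank `≤ 1`).
* [CoatesSujatha2005] J. Coates, R. Sujatha, *Math. Ann.* 331 (2005), §3 (Conjecture A).
-/

set_option autoImplicit false

set_option linter.dupNamespace false

open scoped Classical

universe u

namespace Summit.BirchSwinnertonDyer.BirchSwinnertonDyer.Theorems.FineSelmerRankOneAnchor

open NumberField IsDedekindDomain Field
open WeierstrassCurve Literature.NumberTheory.EllipticCurves
  Literature.NumberTheory.EllipticCurves.GreenbergSelmer
  Literature.NumberTheory.EllipticCurves.IwasawaAlgebra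
  Literature.NumberTheory.EllipticCurves.Rank1Residual
  Literature.NumberTheory.EllipticCurves.Rank1Residual.Typed
  Literature.NumberTheory.EllipticCurves.ZpExtension
  Summit.BirchSwinnertonDyer.Rank1Residual Summit.BirchSwinnertonDyer.Rank1Residual.Additive
  Summit.BirchSwinnertonDyer.Rank1Residual.O6
  Summit.BirchSwinnertonDyer.BirchSwinnertonDyer.Theorems

/-! ## §1 K9: the wild `3`, class O6 rows (`WildFineSelmerCoatesSujatha`, item 19386) -/

/-- **THE RANK-ONE FINE ANCHOR ROAD, K9 row form.** Let `W/ℚ` be globally minimal with `r_an = 0`, class O6 at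
`3`, `W[3]` irreducible, and `W′/ℚ` an elliptic curve with `W′[3] ≅ W[3]` (any reduction type) with: a finite
`S ∋ v₀ ∣ 3` off which `W′` is good and `v ∤ 3`; `#Ш(W′/ℚ)[3^∞] = 1`; `W′(ℚ) = ℤ·P ⊕ T`, `m·T = 0`, `3 ∤ m`;
`P` without `D_{v₀}`-fixed third root in `W′(ℚ̄)`; and no non-zero `D_v`-fixed `3`-torsion in `W′[3^∞]` for
`v ∈ S`. Then `ord₃ #Ш(W) ≤ ord₃ #Ш_an(W)`. [cite: GreenbergLNM1716, §2 and Prop. 3.8 (pp. 95–96)]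
[cite: LimSujatha2018, §3 Prop. 3.2] [cite: Kato2004Asterisque, Thm. 14.5 (3) and Prop. 14.16 (2)] -/
theorem missingUpperBoundAt_wild_of_rankOneFineAnchor
    (hLS : LimSujatha2018.prop32_fineSelmerDual_moduleFinite_iff_of_torsionIso)
    (hKatoA :
      Kato2004.rankZero_padicValNat_sha_add_padicValNat_tamagawa_le_of_additive_potGood_of_irreducible_of_fineSelmerDual_fg)
    (hGZK : rank_eq_analyticRank_of_analyticRank_le_one) (hmod : hasEntireLFunction_rat)
    (W : WeierstrassCurve ℚ) [W.IsElliptic] [W.IsGloballyMinimal] [Fact (3 : ℕ).Prime]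
    (hr : W.analyticRank = 0) (hO : ClassO6 W 3) (hirr : W.HasIrreducibleModPGaloisRep 3)
    (W' : WeierstrassCurve ℚ) [W'.IsElliptic] (hcong : ModPCongruent W' W 3)
    (S : Finset (HeightOneSpectrum (𝓞 ℚ)))
    (hS : ∀ v ∉ S, ((3 : ℕ) : 𝓞 ℚ) ∉ v.asIdeal ∧ W'.HasGoodReductionAt v)
    {v₀ : HeightOneSpectrum (𝓞 ℚ)} (hv₀S : v₀ ∈ S) (hv₀p : ((3 : ℕ) : 𝓞 ℚ) ∈ v₀.asIdeal)
    (hsha' : Nat.card (AddCommGroup.primaryComponent W'.sha 3) = 1)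
    (P : W'.toAffine.Point) {m : ℕ} (hm : ¬ 3 ∣ m)
    (hgen : letI := Classical.decEq ℚ
      ∀ R : W'.toAffine.Point, ∃ (n : ℤ) (T : W'.toAffine.Point), m • T = 0 ∧ R = n • P + T)
    (hindiv : ∀ Q : WeierstrassCurve.geomPoints W', (∀ d ∈ decomp v₀, d • Q = Q) →
      3 • Q ≠ WeierstrassCurve.toGeomPoints W' P)
    (hloc' : ∀ v ∈ S, ∀ x : W'.geomPrimaryTorsion 3, 3 • x = 0 → (∀ d ∈ decomp v, d • x = x) → x = 0) :
    MissingUpperBoundAt W 3 :=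
  WildFineSelmerSupersingularCMAnchor.missingUpperBoundAt_wild_of_conjA hKatoA hGZK hmod W hr hO hirr
    (WildFineSelmerCongruenceFact.conjA_of_modPCongruent hLS (by norm_num) hcong
      (FineSelmerControl.conjA_rat_of_rankOne W' S hS hv₀S hv₀p hsha' P hm hgen hindiv hloc'))

/-- **K9 rank-one anchor of SMALL CONDUCTOR** (`N_{W′} < 5000`, `rank W′(ℚ) ≤ 1`, `Ш_an(W′) = k`, `3 ∤ k`:
`#Ш(W′) = k` by bsd.S31 / Creutz–Miller through g4's `natCard_sha_eq_of_conductor_lt_of_shaAn_eq`, so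
`#Ш(W′)[3^∞] = 1`); the form the census rows use (e.g. 6912h1 ↔ 256b1). [cite: CreutzMiller2012, Thm. 1.1]
[cite: GreenbergLNM1716, §2 and Prop. 3.8 (pp. 95–96)] [cite: LimSujatha2018, §3 Prop. 3.2] -/
theorem missingUpperBoundAt_wild_of_smallConductorRankOneFineAnchor
    (hLS : LimSujatha2018.prop32_fineSelmerDual_moduleFinite_iff_of_torsionIso)
    (hKatoA :
      Kato2004.rankZero_padicValNat_sha_add_padicValNat_tamagawa_le_of_additive_potGood_of_irreducible_of_fineSelmerDual_fg)
    (hGZK : rank_eq_analyticRank_of_analyticRank_le_one) (hmod : hasEntireLFunction_rat)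
    (hS31 : bsdTriple_of_rank_le_one_of_conductor_lt)
    (W : WeierstrassCurve ℚ) [W.IsElliptic] [W.IsGloballyMinimal] [Fact (3 : ℕ).Prime]
    (hr : W.analyticRank = 0) (hO : ClassO6 W 3) (hirr : W.HasIrreducibleModPGaloisRep 3)
    (W' : WeierstrassCurve ℚ) [W'.IsElliptic] [W'.IsGloballyMinimal] (hcong : ModPCongruent W' W 3)
    (hN' : W'.conductorNorm ℤ < 5000) (hrank' : W'.mordellWeilRank ≤ 1)
    {k : ℕ} (hshaAn' : shaAn W' = (k : ℂ)) (hk : ¬ 3 ∣ k)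
    (S : Finset (HeightOneSpectrum (𝓞 ℚ)))
    (hS : ∀ v ∉ S, ((3 : ℕ) : 𝓞 ℚ) ∉ v.asIdeal ∧ W'.HasGoodReductionAt v)
    {v₀ : HeightOneSpectrum (𝓞 ℚ)} (hv₀S : v₀ ∈ S) (hv₀p : ((3 : ℕ) : 𝓞 ℚ) ∈ v₀.asIdeal)
    (P : W'.toAffine.Point) {m : ℕ} (hm : ¬ 3 ∣ m)
    (hgen : letI := Classical.decEq ℚ
      ∀ R : W'.toAffine.Point, ∃ (n : ℤ) (T : W'.toAffine.Point), m • T = 0 ∧ R = n • P + T)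
    (hindiv : ∀ Q : WeierstrassCurve.geomPoints W', (∀ d ∈ decomp v₀, d • Q = Q) →
      3 • Q ≠ WeierstrassCurve.toGeomPoints W' P)
    (hloc' : ∀ v ∈ S, ∀ x : W'.geomPrimaryTorsion 3, 3 • x = 0 → (∀ d ∈ decomp v, d • x = x) → x = 0) :
    MissingUpperBoundAt W 3 := by
  obtain ⟨hfin, hcard⟩ :=
    WildFineSelmerSmallConductorAnchor.natCard_sha_eq_of_conductor_lt_of_shaAn_eq hS31 W' hrank' hN' hshaAn'
  haveI : Finite W'.sha := hfin
  have h1 : Nat.card (AddCommGroup.primaryComponent W'.sha 3) = 1 := by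
    rw [card_addPrimaryComponent_eq_pow 3, hcard, Nat.factorization_eq_zero_of_not_dvd hk, pow_zero]
  exact missingUpperBoundAt_wild_of_rankOneFineAnchor hLS hKatoA hGZK hmod W hr hO hirr W' hcong S hS hv₀S
    hv₀p h1 P hm hgen hindiv hloc'

/-! ## §2 KT: additive potentially-good odd `p`, sub-t′ rows (`TameFineSelmerCoatesSujatha`, item 19413) -/

/-- **THE RANK-ONE FINE ANCHOR ROAD, KT row form** (`p` odd, `Addv W p`, `0 ≤ ord_p j`, `W[p]` irreducible;
anchor data as in §1 at `p`). Then `ord_p #Ш(W) ≤ ord_p #Ш_an(W)`.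
[cite: GreenbergLNM1716, §2 and Prop. 3.8 (pp. 95–96)] [cite: LimSujatha2018, §3 Prop. 3.2]
[cite: Kato2004Asterisque, Thm. 14.5 (3) (p. 236) and Prop. 14.16 (2) (p. 244)] -/
theorem missingUpperBoundAt_addv_of_rankOneFineAnchor
    (hLS : LimSujatha2018.prop32_fineSelmerDual_moduleFinite_iff_of_torsionIso)
    (hKatoA :
      Kato2004.rankZero_padicValNat_sha_add_padicValNat_tamagawa_le_of_additive_potGood_of_irreducible_of_fineSelmerDual_fg)
    (hGZK : rank_eq_analyticRank_of_analyticRank_le_one) (hmod : hasEntireLFunction_rat)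
    (W : WeierstrassCurve ℚ) [W.IsElliptic] [W.IsGloballyMinimal] (p : ℕ) [Fact p.Prime]
    (hr : W.analyticRank = 0) (hp : p ≠ 2) (hA : Addv W p) (hj : 0 ≤ padicValRat p W.j)
    (hirr : W.HasIrreducibleModPGaloisRep p)
    (W' : WeierstrassCurve ℚ) [W'.IsElliptic] (hcong : ModPCongruent W' W p)
    (S : Finset (HeightOneSpectrum (𝓞 ℚ)))
    (hS : ∀ v ∉ S, ((p : ℕ) : 𝓞 ℚ) ∉ v.asIdeal ∧ W'.HasGoodReductionAt v)
    {v₀ : HeightOneSpectrum (𝓞 ℚ)} (hv₀S : v₀ ∈ S) (hv₀p : ((p : ℕ) : 𝓞 ℚ) ∈ v₀.asIdeal)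
    (hsha' : Nat.card (AddCommGroup.primaryComponent W'.sha p) = 1)
    (P : W'.toAffine.Point) {m : ℕ} (hm : ¬ p ∣ m)
    (hgen : letI := Classical.decEq ℚ
      ∀ R : W'.toAffine.Point, ∃ (n : ℤ) (T : W'.toAffine.Point), m • T = 0 ∧ R = n • P + T)
    (hindiv : ∀ Q : WeierstrassCurve.geomPoints W', (∀ d ∈ decomp v₀, d • Q = Q) →
      p • Q ≠ WeierstrassCurve.toGeomPoints W' P)
    (hloc' : ∀ v ∈ S, ∀ x : W'.geomPrimaryTorsion p, p • x = 0 → (∀ d ∈ decomp v, d • x = x) → x = 0) :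
    MissingUpperBoundAt W p :=
  TameFineSelmerSupersingularUnitAnchor.missingUpperBoundAt_addv_of_conjA hKatoA hGZK hmod W p hr hp hA hj
    hirr
    (WildFineSelmerCongruenceFact.conjA_of_modPCongruent hLS hp hcong
      (FineSelmerControl.conjA_rat_of_rankOne W' S hS hv₀S hv₀p hsha' P hm hgen hindiv hloc'))

/-- **KT rank-one anchor of SMALL CONDUCTOR** (`N_{W′} < 5000`, `rank W′(ℚ) ≤ 1`, `Ш_an(W′) = k`, `p ∤ k`;
e.g. 19494q1/x1 ↔ 361a1 at `p = 3`). [cite: CreutzMiller2012, Thm. 1.1]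
[cite: GreenbergLNM1716, §2 and Prop. 3.8 (pp. 95–96)] [cite: LimSujatha2018, §3 Prop. 3.2] -/
theorem missingUpperBoundAt_addv_of_smallConductorRankOneFineAnchor
    (hLS : LimSujatha2018.prop32_fineSelmerDual_moduleFinite_iff_of_torsionIso)
    (hKatoA :
      Kato2004.rankZero_padicValNat_sha_add_padicValNat_tamagawa_le_of_additive_potGood_of_irreducible_of_fineSelmerDual_fg)
    (hGZK : rank_eq_analyticRank_of_analyticRank_le_one) (hmod : hasEntireLFunction_rat)
    (hS31 : bsdTriple_of_rank_le_one_of_conductor_lt)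
    (W : WeierstrassCurve ℚ) [W.IsElliptic] [W.IsGloballyMinimal] (p : ℕ) [Fact p.Prime]
    (hr : W.analyticRank = 0) (hp : p ≠ 2) (hA : Addv W p) (hj : 0 ≤ padicValRat p W.j)
    (hirr : W.HasIrreducibleModPGaloisRep p)
    (W' : WeierstrassCurve ℚ) [W'.IsElliptic] [W'.IsGloballyMinimal] (hcong : ModPCongruent W' W p)
    (hN' : W'.conductorNorm ℤ < 5000) (hrank' : W'.mordellWeilRank ≤ 1)
    {k : ℕ} (hshaAn' : shaAn W' = (k : ℂ)) (hk : ¬ p ∣ k)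
    (S : Finset (HeightOneSpectrum (𝓞 ℚ)))
    (hS : ∀ v ∉ S, ((p : ℕ) : 𝓞 ℚ) ∉ v.asIdeal ∧ W'.HasGoodReductionAt v)
    {v₀ : HeightOneSpectrum (𝓞 ℚ)} (hv₀S : v₀ ∈ S) (hv₀p : ((p : ℕ) : 𝓞 ℚ) ∈ v₀.asIdeal)
    (P : W'.toAffine.Point) {m : ℕ} (hm : ¬ p ∣ m)
    (hgen : letI := Classical.decEq ℚ
      ∀ R : W'.toAffine.Point, ∃ (n : ℤ) (T : W'.toAffine.Point), m • T = 0 ∧ R = n • P + T)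
    (hindiv : ∀ Q : WeierstrassCurve.geomPoints W', (∀ d ∈ decomp v₀, d • Q = Q) →
      p • Q ≠ WeierstrassCurve.toGeomPoints W' P)
    (hloc' : ∀ v ∈ S, ∀ x : W'.geomPrimaryTorsion p, p • x = 0 → (∀ d ∈ decomp v, d • x = x) → x = 0) :
    MissingUpperBoundAt W p := by
  obtain ⟨hfin, hcard⟩ :=
    WildFineSelmerSmallConductorAnchor.natCard_sha_eq_of_conductor_lt_of_shaAn_eq hS31 W' hrank' hN' hshaAn'
  haveI : Finite W'.sha := hfin
  have h1 : Nat.card (AddCommGroup.primaryComponent W'.sha p) = 1 := by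
    rw [card_addPrimaryComponent_eq_pow p, hcard, Nat.factorization_eq_zero_of_not_dvd hk, pow_zero]
  exact missingUpperBoundAt_addv_of_rankOneFineAnchor hLS hKatoA hGZK hmod W p hr hp hA hj hirr W' hcong S hS
    hv₀S hv₀p h1 P hm hgen hindiv hloc'

end Summit.BirchSwinnertonDyer.BirchSwinnertonDyer.Theorems.FineSelmerRankOneAnchor
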